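import Summits.RiemannHypothesis.RiemannHypothesis.Theorems.JensenLogBandLogDerivTransfer
import Summits.RiemannHypothesis.RiemannHypothesis.Theorems.JensenLogBandArcHolomorphic
import Summits.RiemannHypothesis.RiemannHypothesis.Theorems.JensenLogBandTopShellRegime
import HarnessLib

/-!
# The x-uniform composition frame of the near zone (BAND line, `stub_shellNear`)

RH ladder column JENSEN, rung J-P(P3) «log band», BAND crux `XiDerivBandRealAllRates` of route
«JensenLogBand», line «band-one-window» (u-arc, top-shell reshape), lead rh-jensen-prover g8 —
drafted by the custodian rh-jensen-theory g12 (THEORY NOTE #4 §7 (B), `NEAR-ZONE-CHECK.md`) for the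
lead / a hand to land verbatim `--supports stmt-RiemannHypothesis-19913 --as helper`.
RH-FREE, pure complex analysis. WHAT THIS IS NOT: nothing here bears on zeros of `ζ` off the line or
the truth of RH.

* `norm_lt_norm_of_disc_models`: if at every point of a horizontal segment `{x + iT : x ∈ [a, b]}`
  `U` is holomorphic on the `R'`-disc and there is SOME model `M`, holomorphic and zero-free on that
  disc, with `‖U − M‖ ≤ ε‖M‖` on the closed `R`-disc (`0 < R < R'`, `0 ≤ ε < 1`) and
  `ε/(R(1−ε)) < Re (M′/M)` at the centre, then
  `‖U(a+iT)‖ < ‖U(b+iT)‖`. (= `LogDerivTransfer.re_logDeriv_ge_of_norm_sub_le` at each point +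
  `LogDerivTransfer.norm_lt_norm_of_re_logDeriv_pos` on the segment; the model may vary with the point —
  on the BAND line it is the translated-saddle model `arcShiftModel k (x+iT) u*(x+iT)`.)
* `shellNear_of_discModels`: the OUTER composition — `stub_shellNear` of the lead skeleton
  (`Cruxes/XiDerivBandRealAllRates/TopShellLead`, rate `7 ≤ c < 8`, near zone `0 < a ≤ 2/c − ¼`)
  follows from disc models supplied at every near point `x + iT`, `|x| ≤ 2/c − ¼`, under the x-FREE
  pins of the top shell (`T, ℓ_T ≥ 200`, `c(k−1)/2 − 4 ≤ ℓ_T ≤ ck/2`, `4/c < h ≤ 4/c + 1/log k`,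
  `h ≤ 7T/20`, `1/T ≤ 2(2/c − ¼)`), eventually in `k` — via `topShell_regime_norm`,
  `differentiableOn_xiSqArcU` and the frame with `R = 2/ℓ_T < R' = 3/ℓ_T`. The disc models are the
  analytic content (S5 assembled + [CMP] + `re_logDeriv_arcShiftModel_centre_ge_ell`, NOTE #4).
-/

noncomputable section

-- single-problem summit: `Summit.RiemannHypothesis.RiemannHypothesis.…` is the tree convention
set_option linter.dupNamespace false

open Complex Real Set Metric

namespace Summit.RiemannHypothesis.RiemannHypothesis.Theorems.JensenPolynomials.LogBandArc

/-- **Composition frame of the near zone** (x-uniform; pure complex analysis). If at every point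
`x + iT` of a horizontal segment (`x ∈ [a, b]`, `a < b`) the function `U` is holomorphic on the open
`R'`-disc and there is a model `M`, holomorphic and zero-free on that disc, with
`‖U z − M z‖ ≤ ε ‖M z‖` on the closed `R`-disc (`0 < R < R'`, `0 ≤ ε < 1`) and
`ε/(R(1−ε)) < Re (M′/M)(x+iT)`, then `‖U(a+iT)‖ < ‖U(b+iT)‖`. [folklore] -/
theorem norm_lt_norm_of_disc_models {U : ℂ → ℂ} {a b T R R' : ℝ} (hab : a < b) (hR : 0 < R)
    (hRR' : R < R')
    (hU : ∀ x ∈ Icc a b, DifferentiableOn ℂ U (ball ((x : ℂ) + (T : ℂ) * I) R'))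
    (hmodel : ∀ x ∈ Icc a b, ∃ (M : ℂ → ℂ) (ε : ℝ), 0 ≤ ε ∧ ε < 1 ∧
      DifferentiableOn ℂ M (ball ((x : ℂ) + (T : ℂ) * I) R') ∧
      (∀ z ∈ ball ((x : ℂ) + (T : ℂ) * I) R', M z ≠ 0) ∧
      (∀ z ∈ closedBall ((x : ℂ) + (T : ℂ) * I) R, ‖U z - M z‖ ≤ ε * ‖M z‖) ∧
      ε / (R * (1 - ε)) <
        (deriv M ((x : ℂ) + (T : ℂ) * I) / M ((x : ℂ) + (T : ℂ) * I)).re) :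
    ‖U ((a : ℂ) + (T : ℂ) * I)‖ < ‖U ((b : ℂ) + (T : ℂ) * I)‖ := by
  -- the horizontal restriction `φ(y) = U(y + iT)` and its derivative
  set φ : ℝ → ℂ := fun y => U ((y : ℂ) + (T : ℂ) * I) with hφ
  set φ' : ℝ → ℂ := fun y => deriv U ((y : ℂ) + (T : ℂ) * I) with hφ'
  have hR' : 0 < R' := hR.trans hRR'
  -- differentiability of `U` at the points of the segment
  have hdiffAt : ∀ x ∈ Icc a b, DifferentiableAt ℂ U ((x : ℂ) + (T : ℂ) * I) := fun x hx =>
    (hU x hx).differentiableAt (isOpen_ball.mem_nhds (mem_ball_self hR'))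
  have hderiv : ∀ x ∈ Icc a b, HasDerivAt φ (φ' x) x := by
    intro x hx
    have h1 : HasDerivAt U (deriv U ((x : ℂ) + (T : ℂ) * I)) ((x : ℂ) + (T : ℂ) * I) :=
      (hdiffAt x hx).hasDerivAt
    have h2 : HasDerivAt (fun z : ℂ => z + (T : ℂ) * I) 1 (x : ℂ) := (hasDerivAt_id _).add_const _
    have h3 : HasDerivAt (fun z : ℂ => U (z + (T : ℂ) * I))
        (deriv U ((x : ℂ) + (T : ℂ) * I) * 1) (x : ℂ) := HasDerivAt.comp (x : ℂ) h1 h2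
    rw [mul_one] at h3
    exact h3.comp_ofReal
  -- zero-freeness and positivity of the log-derivative, pointwise from the models
  have hkey : ∀ x ∈ Icc a b, φ x ≠ 0 ∧ 0 < (φ' x / φ x).re := by
    intro x hx
    obtain ⟨M, ε, hε0, hε1, hM, hM0, happrox, hgap⟩ := hmodel x hx
    set v₀ : ℂ := (x : ℂ) + (T : ℂ) * I with hv₀
    have hMv : M v₀ ≠ 0 := hM0 v₀ (mem_ball_self hR')
    have hUv : U v₀ ≠ 0 := by
      intro h0
      have h1 := happrox v₀ (mem_closedBall_self hR.le)
      rw [h0, zero_sub, norm_neg] at h1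
      have h2 : 0 < ‖M v₀‖ := norm_pos_iff.2 hMv
      nlinarith
    have htr := LogBand.LogDerivTransfer.re_logDeriv_ge_of_norm_sub_le hR hRR' hε0 hε1 (hU x hx) hM
      hM0 happrox
    refine ⟨hUv, ?_⟩
    show 0 < (deriv U v₀ / U v₀).re
    linarith
  exact LogBand.LogDerivTransfer.norm_lt_norm_of_re_logDeriv_pos hab hderiv
    (fun x hx => (hkey x hx).1) (fun x hx => (hkey x (Ioo_subset_Icc_self hx)).2)

/-! ## The outer composition: `stub_shellNear` from disc models at the near points -/

/-- **`stub_shellNear` from disc models (RH-FREE glue).** Fix a rate `7 ≤ c < 8` and put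
`a₀ = 2/c − ¼`. Suppose that, eventually in `k`, at every near point `x + iT` (`|x| ≤ a₀`) carrying
the x-free pins of the top shell there is a model `M`, holomorphic and zero-free on the `3/ℓ_T`-disc,
with `‖U_h − M‖ ≤ ε‖M‖` on the closed `2/ℓ_T`-disc (`h = bandRadius k T` FIXED) and
`ε/((2/ℓ_T)(1−ε)) < Re(M′/M)` at the centre. Then the conclusion of `stub_shellNear` holds at rate
`c`: eventually in `k`, `‖U_h(−a+iT)‖ < ‖U_h(a+iT)‖` for `0 < a ≤ a₀`, `0 < T` on the top shell
`e^{c(k−1)}/4 ≤ ‖(a+iT)²‖ < e^{ck}`. [folklore] -/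
theorem shellNear_of_discModels {c : ℝ} (hc7 : 7 ≤ c) (hc8 : c < 8)
    (hdisc : ∃ k₁ : ℕ, ∀ k : ℕ, k₁ ≤ k → ∀ x T : ℝ, |x| ≤ 2 / c - 1 / 4 → 200 ≤ T →
      200 ≤ ell T → c * ((k : ℝ) - 1) / 2 - 4 ≤ ell T → ell T ≤ c * (k : ℝ) / 2 →
      4 / c < bandRadius k T → bandRadius k T ≤ 4 / c + 1 / Real.log k →
      bandRadius k T ≤ 7 / 20 * T → 1 / T ≤ 2 * (2 / c - 1 / 4) →
      ∃ (M : ℂ → ℂ) (ε : ℝ), 0 ≤ ε ∧ ε < 1 ∧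
        DifferentiableOn ℂ M (ball ((x : ℂ) + (T : ℂ) * I) (3 / ell T)) ∧
        (∀ z ∈ ball ((x : ℂ) + (T : ℂ) * I) (3 / ell T), M z ≠ 0) ∧
        (∀ z ∈ closedBall ((x : ℂ) + (T : ℂ) * I) (2 / ell T),
          ‖xiSqArcU k (bandRadius k T) z - M z‖ ≤ ε * ‖M z‖) ∧
        ε / (2 / ell T * (1 - ε)) <
          (deriv M ((x : ℂ) + (T : ℂ) * I) / M ((x : ℂ) + (T : ℂ) * I)).re) :
    ∃ k₁ : ℕ, ∀ k : ℕ, k₁ ≤ k → ∀ a T : ℝ, 0 < a → a ≤ 2 / c - 1 / 4 → 0 < T →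
      Real.exp (c * ((k : ℝ) - 1)) / 4 ≤ ‖((a : ℂ) + (T : ℂ) * I) ^ 2‖ →
      ‖((a : ℂ) + (T : ℂ) * I) ^ 2‖ < Real.exp (c * (k : ℝ)) →
      ‖xiSqArcU k (bandRadius k T) (-(a : ℂ) + (T : ℂ) * I)‖ <
        ‖xiSqArcU k (bandRadius k T) ((a : ℂ) + (T : ℂ) * I)‖ := by
  obtain ⟨k₁, hk₁⟩ := hdisc
  have hc0 : 0 < c := by linarith
  -- the near half-width `a₀ = 2/c − ¼ ∈ (0, ½)`
  have ha₀ : 0 < 2 / c - 1 / 4 := by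
    have : 1 / 4 < 2 / c := by rw [div_lt_div_iff₀ (by norm_num) hc0]; linarith
    linarith
  have ha₀' : 2 / c - 1 / 4 ≤ 1 / 2 := by
    have : 2 / c ≤ 2 / 7 := div_le_div_of_nonneg_left (by norm_num) (by norm_num) hc7
    linarith
  -- the log-height floor `ℓ₀`: `ℓ_T ≥ ℓ₀` forces `T ≥ 200` and `1/T ≤ 2a₀`
  set ℓ₀ : ℝ := max 200 (Real.log (1 / (2 * (2 / c - 1 / 4)))) with hℓ₀
  obtain ⟨k₀, hk₀⟩ := topShell_regime_norm ℓ₀ c hc0 hc8.le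
  refine ⟨max k₀ k₁, fun k hk a T ha haa₀ hT hlo hhi => ?_⟩
  have ha2 : a ≤ 1 / 2 := haa₀.trans ha₀'
  obtain ⟨-, hT100, hℓ₀T, hellLo, hellHi, hh12, hh720, hh4c, hh4c'⟩ :=
    hk₀ k (le_trans (le_max_left _ _) hk) a T ha ha2 hT hlo hhi
  have hℓ200 : 200 ≤ ell T := le_trans (le_max_left _ _) hℓ₀T
  have hℓlog : Real.log (1 / (2 * (2 / c - 1 / 4))) ≤ ell T := le_trans (le_max_right _ _) hℓ₀T
  -- `T = 2π e^{ℓ_T}`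
  have hTexp : T = 2 * π * Real.exp (ell T) := by
    rw [ell, Real.exp_log (by positivity)]; field_simp
  have h2pi : 1 ≤ 2 * π := by linarith [Real.pi_gt_three]
  have hT200 : 200 ≤ T := by
    have h1 : (200 : ℝ) ≤ Real.exp 200 := by
      have := Real.add_one_le_exp (200 : ℝ); linarith
    have h2 : Real.exp 200 ≤ Real.exp (ell T) := Real.exp_le_exp.2 hℓ200
    have h3 : Real.exp (ell T) ≤ 2 * π * Real.exp (ell T) :=
      le_mul_of_one_le_left (Real.exp_pos _).le h2pi
    linarith
  have h1T : 1 / T ≤ 2 * (2 / c - 1 / 4) := by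
    have h1 : 1 / (2 * (2 / c - 1 / 4)) ≤ Real.exp (ell T) := by
      have := Real.exp_le_exp.2 hℓlog
      rwa [Real.exp_log (by positivity)] at this
    have h3 : Real.exp (ell T) ≤ T :=
      calc Real.exp (ell T) ≤ 2 * π * Real.exp (ell T) :=
            le_mul_of_one_le_left (Real.exp_pos _).le h2pi
        _ = T := hTexp.symm
    rw [div_le_iff₀ hT]
    have h4 : 1 / (2 * (2 / c - 1 / 4)) ≤ T := h1.trans h3
    rw [div_le_iff₀ (by positivity)] at h4
    linarith
  -- the frame on the segment `[−a, a] × {T}` with `R = 2/ℓ_T < R' = 3/ℓ_T`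
  have hℓ0 : 0 < ell T := by linarith
  have hR : 0 < 2 / ell T := by positivity
  have hRR' : 2 / ell T < 3 / ell T := by
    rw [div_lt_div_iff₀ hℓ0 hℓ0]; nlinarith
  have hh0 : 0 < bandRadius k T := by linarith
  have hU : ∀ x ∈ Icc (-a) a,
      DifferentiableOn ℂ (xiSqArcU k (bandRadius k T)) (ball ((x : ℂ) + (T : ℂ) * I) (3 / ell T)) := by
    intro x _
    refine (differentiableOn_xiSqArcU k hh0).mono ?_
    intro v hv
    have hv' : ‖v - ((x : ℂ) + (T : ℂ) * I)‖ < 3 / ell T := by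
      rwa [mem_ball, dist_eq_norm] at hv
    have h3 : 3 / ell T ≤ 3 / 200 := div_le_div_of_nonneg_left (by norm_num) (by norm_num) hℓ200
    have him : |v.im - T| ≤ 3 / 200 := by
      have e : v.im - T = (v - ((x : ℂ) + (T : ℂ) * I)).im := by simp
      rw [e]; exact (Complex.abs_im_le_norm _).trans (hv'.le.trans h3)
    have him' := abs_le.1 him
    have hvn : v.im ≤ ‖v‖ := le_trans (le_abs_self _) (Complex.abs_im_le_norm v)
    show bandRadius k T < 2 * ‖v‖
    linarith
  have hmodel : ∀ x ∈ Icc (-a) a, ∃ (M : ℂ → ℂ) (ε : ℝ), 0 ≤ ε ∧ ε < 1 ∧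
      DifferentiableOn ℂ M (ball ((x : ℂ) + (T : ℂ) * I) (3 / ell T)) ∧
      (∀ z ∈ ball ((x : ℂ) + (T : ℂ) * I) (3 / ell T), M z ≠ 0) ∧
      (∀ z ∈ closedBall ((x : ℂ) + (T : ℂ) * I) (2 / ell T),
        ‖xiSqArcU k (bandRadius k T) z - M z‖ ≤ ε * ‖M z‖) ∧
      ε / (2 / ell T * (1 - ε)) <
        (deriv M ((x : ℂ) + (T : ℂ) * I) / M ((x : ℂ) + (T : ℂ) * I)).re := by
    intro x hx
    have hxa : |x| ≤ 2 / c - 1 / 4 := (abs_le.2 ⟨hx.1, hx.2⟩).trans haa₀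
    exact hk₁ k (le_trans (le_max_right _ _) hk) x T hxa hT200 hℓ200 hellLo hellHi hh4c hh4c'
      hh720 h1T
  have key := norm_lt_norm_of_disc_models (U := xiSqArcU k (bandRadius k T)) (T := T)
    (show -a < a by linarith) hR hRR' hU hmodel
  simpa using key

end Summit.RiemannHypothesis.RiemannHypothesis.Theorems.JensenPolynomials.LogBandArc

end
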